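import Literature.MathematicalPhysics.QuantumFieldTheory.Balaban1983to89.B9Thm31SiteGradGpDivDecayReg335Y
import Literature.MathematicalPhysics.QuantumFieldTheory.Balaban1983to89.B9Thm31SiteGpWeightedReg335Y

/-!
# `Balaban1983to89.B9Thm31SiteGpGradWeightedReg335Y` — T. Bałaban, *Propagators for lattice gauge theories in a background field*, Commun. Math. Phys. **99**
# (1985) 389–434 [Balaban1985BackgroundPropagators] Thm 3.1 (3.47) p. 398 (the entry `|∇_UG′(U)λ|_{(1+γ)} ≤ B₀|λ|_{(γ)}`) with (3.41) p. 397, by S. Agmon's method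
# [Agmon1982]: ★★★ **THE GLOBAL WEIGHTED `L²` GRADIENT ESTIMATE FOR def-Y's `G′(U)` ON THE (3.35) CLASS** — for EVERY admissible weight `ω`:
# `Σ_zΣ_ν ω_z²·HS((∇_{U,ν}G′(U)Ψ)(z)) ≤ 160·Σ_z (L^{lev z})²·ω_z²·HS(Ψ(z))` — «`∇G′` costs ONE power of the local scale, through any Agmon weight»; at `ω ≡ 1` the
# `L²` form of (3.47)'s gradient entry at `γ = −1`, with `ω = e^{δ₀ρ}` its exponentially weighted version (file 17 of the site-coercivity set of width seat
# `pub-ymgap-dag-n06-w1`)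

statement-level skeleton of published theorems with citation tags; proofs where landed; nothing here is a claim about the Yang–Mills mass gap

THE PRINT (p. 398).  (3.47): *«|G′(U)λ|_{(2+γ)}, |∇_UG′(U)λ|_{(1+γ)}, |G′(U)∇\*_Uλ|_{(1+γ)}, … ≤ B₀|λ|_{(γ)}»* with the scale-weighted norms (3.41)
`|A|_{(α)} = sup_j sup_{Ω_j∖Ω_{j+1}} (Lʲη)^{−α}|A|` — the gradient of `G′λ` costs one power of the local scale less than `G′λ`.  This file is the `L²` analogue at
`γ = −1` (output weight `(Lʲη)⁰`, input weight `(Lʲη)^{+1}`), uniformly through any admissible exponential weight.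

WHY THIS FILE ∕ THE ARGUMENT.  With `Φ = G′(U)Ψ`, an admissible `ω`, `M = Σ_z m_zω_z²HS(Φ z)`, `R = Σ_z m_z⁻¹ω_z²HS(Ψ z)`, `X = ⟨ω²Φ, Ψ⟩₁`, `κ = (d+1)θ_b + θ_s∕2 ≤ 1∕16`,
`c₀ = 1∕8 − κ ≥ 1∕16`: file 10 gives `c₀M ≤ X ≤ √M√R` (so `X ≤ R∕c₀`, `M ≤ R∕c₀²`); file 5b's defect bound and file 8's energy domination give
`Σ_ν‖∇_ν(ωΦ)‖² ≤ X + κM`; file 14's summed per-bond algebra gives `Σ_zΣ_νω_z²HS(∇_νΦ z) ≤ 2Σ_ν‖∇_ν(ωΦ)‖² + 6(d+1)θ_bM`; hence the total is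
`≤ 2X + (2κ + 6(d+1)θ_b)M ≤ 32R + 128R = 160R`.

WHAT IS PROVED (sorry-free; 0 `def`; nothing of [B9] asserted beyond what is proved).
* `gradw_arith` (the real arithmetic), ★★★ **`wsq_grad_GpY_le`** (on Reg335, for every admissible `ω` and every `Ψ`:
  `Σ_zΣ_ν ω_z²HS((∇_{U,ν}G′(U)Ψ)(z)) ≤ 160·Σ_z (L^{lev z})²·HS(ω_zΨ(z))`), ★★ **`grad_GpY_le`** (`ω ≡ 1`: `Σ_ν‖∇_{U,ν}G′(U)Ψ‖²₁ ≤ 160·Σ_z (L^{lev z})²HS(Ψ z)`),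
  ★★★ **`wsq_exp_grad_GpY_le_canonical`** (`ω = e^{δ₀ρ}`, `δ₀ = 1∕(4(d+2))`).
MODEL ∕ DECLARED READINGS.  As files 6–10; (3.47) is printed in SUP norms — this is its `L²` analogue at one `γ`, declared so.  NON-VACUITY (A6): `ω ≡ 1`, `e^{δ₀ρ}`
with `ρ ≡ 0` or the torus exponent of file 15.  HONEST SCOPE.  A weighted `L²` estimate for one finite lattice operator; NOT a node discharge, NOT summit progress;
count-neutral; nothing continuum ∕ OS ∕ mass gap ∕ Clay.  NEW file importing files 10 and 14 only.
-/

noncomputable section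

namespace Literature.MathematicalPhysics.QuantumFieldTheory.Balaban1983to89.B9Thm31SiteGpGradWeightedReg335Y

open Literature.MathematicalPhysics.QuantumFieldTheory.Balaban1983to89
open Node00 B6KLevelCensusIndexV1 B6Geom246MultiLevelBox B6MultiLevelBoxOperator B6MultiLevelTorusOperator B6GlobalChartV1 B9BackgroundsKLevelV1
  B9Eq39Adjoint B9Thm311ReadingCoords B9Thm311DeltaPrimePos B9Ineq369CurvatureSmallAtLettersY B9Thm31SiteCoerciveGaugeBlockY
  B9Thm31SiteCoerciveReg335Y B9Thm31SiteGpBoundsReg335Y B9Thm31SitePolarisedFormY B9Thm31SiteConjugatedFormY B9Thm31SiteGpDecayReg335Y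
  B9Thm31SiteAgmonWeightY B9Thm31SiteGpGradDecayReg335Y B9Thm31SiteGradGpDivDecayReg335Y B9Thm31SiteGpWeightedReg335Y
open Literature.MathematicalPhysics.QuantumFieldTheory.Balaban1983to89.B9Thm311FlippedBondLetters (hs_real_smul)
open scoped Matrix Matrix.Norms.L2Operator

variable {d ℓ : ℕ} {hd : 1 ≤ d + 1} {hL : Odd (ℓ + 1) ∧ 1 < ℓ + 1} {b₀ b₁ : ℝ}
variable (i : KIdx d ℓ hd hL b₀ b₁) {N : ℕ} {G : Subgroup (Matrix (Fin N) (Fin N) ℂ)ˣ}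

/-- THE ARITHMETIC: `c₀M ≤ X`, `X² ≤ MR`, `E ≤ X + κM`, `S ≤ 2E + 6θM`, `κ, θ ≤ 1∕16`, `M, R ≥ 0` ⇒ `S ≤ 160R`. [cite: Agmon1982, Ch.1, bookkeeping] -/
theorem gradw_arith {X M R E S κ θ : ℝ} (hiX : (1 / 8 - κ) * M ≤ X) (hX2 : X ^ 2 ≤ M * R) (hE : E ≤ X + κ * M) (hS : S ≤ 2 * E + 6 * θ * M)
    (hκ : κ ≤ 1 / 16) (hθ : θ ≤ 1 / 16) (hM0 : 0 ≤ M) (hR0 : 0 ≤ R) : S ≤ 160 * R := by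
  have hc : (1 / 16 : ℝ) ≤ 1 / 8 - κ := by linarith
  have hX0 : 0 ≤ X := le_trans (mul_nonneg (le_trans (by norm_num) hc) hM0) hiX
  -- `(c₀M)² ≤ X² ≤ MR ⇒ c₀²M ≤ R ⇒ M ≤ 256R`; `X² ≤ MR ≤ 256R² ⇒ X ≤ 16R`
  have hM : M ≤ 256 * R := by
    rcases hM0.eq_or_lt with h0 | hpos
    · rw [← h0]; linarith
    · have h1 : ((1 / 8 - κ) * M) ^ 2 ≤ M * R := le_trans (pow_le_pow_left₀ (mul_nonneg (le_trans (by norm_num) hc) hM0) hiX 2) hX2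
      have h2 : (1 / 16 : ℝ) ^ 2 * M ^ 2 ≤ ((1 / 8 - κ) * M) ^ 2 := by
        rw [mul_pow]; exact mul_le_mul_of_nonneg_right (pow_le_pow_left₀ (by norm_num) hc 2) (sq_nonneg M)
      nlinarith
  have hX : X ≤ 16 * R := by
    have h1 : X ^ 2 ≤ (16 * R) ^ 2 := by nlinarith
    have h16 : (0 : ℝ) ≤ 16 * R := by linarith
    exact (pow_le_pow_iff_left₀ hX0 h16 two_ne_zero).1 h1
  nlinarith

/-- ★★★ **THE GLOBAL WEIGHTED `L²` GRADIENT ESTIMATE FOR `G′(U)` ON THE CLASS (3.35)**: `G ≤ U(N)`, `N ≥ 1`, `0 ≤ c·M·α₀`, `c·M·α₀·(d+1) ≤ 1∕16`, `U ∈ Reg335 c α₀`; a weight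
`ω > 0` with bond ratios `q ≤ θ_b·(L^{lev})⁻²` (both ends), block oscillation `q ≤ θ_s`, `0 ≤ θ_b, θ_s`, `(d+1)θ_b + θ_s∕2 ≤ 1∕16`.  THEN for EVERY `Ψ`:
`Σ_zΣ_ν ω_z²·HS((∇_{U,ν}G′(U)Ψ)(z)) ≤ 160·Σ_z (L^{lev z})²·HS(ω_z·Ψ(z))`. [cite: Balaban1985BackgroundPropagators, Thm 3.1 (3.47) p.398, (3.41) p.397; Agmon1982, Ch.1, Thm 1.5] -/
theorem wsq_grad_GpY_le [Nonempty (Fin N)] (hG : G ≤ B7Prop2Explicit.unitaryUnits (Matrix (Fin N) (Fin N) ℂ))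
    {U : CfgY (Matrix (Fin N) (Fin N) ℂ) i} {c α₀ : ℝ} (hC0 : 0 ≤ c * (kGeo i).M * α₀) (hC1 : c * (kGeo i).M * α₀ * ((d : ℝ) + 1) ≤ 1 / 16)
    (hreg : (bg9K (Matrix (Fin N) (Fin N) ℂ) G i).Reg335 c α₀ U) {ω : SiteY i → ℝ} (hω : ∀ z, 0 < ω z) {θb θs : ℝ} (hθb0 : 0 ≤ θb) (hθs0 : 0 ≤ θs)
    (hb1 : ∀ μ z, ω (shiftY i μ z) / ω z + ω z / ω (shiftY i μ z) - 2 ≤ θb * (((((ℓ + 1) ^ (blkOf i.D.toDomains z).1.1 : ℕ) : ℝ)) ^ 2)⁻¹)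
    (hb2 : ∀ μ z, ω (shiftY i μ z) / ω z + ω z / ω (shiftY i μ z) - 2 ≤ θb * (((((ℓ + 1) ^ (blkOf i.D.toDomains (shiftY i μ z)).1.1 : ℕ) : ℝ)) ^ 2)⁻¹)
    (hs : ∀ z w : SiteY i, blkOf i.D.toDomains w = blkOf i.D.toDomains z → ω z / ω w + ω w / ω z - 2 ≤ θs)
    (hκ : ((d : ℝ) + 1) * θb + θs / 2 ≤ 1 / 16) (Ψ : SiteY i → Matrix (Fin N) (Fin N) ℂ) :
    ∑ z : SiteY i, ∑ ν : Fin (d + 1), ω z ^ 2 * ∑ a, ∑ b, ‖cdS i U ν (GpY i (parSymY i) U Ψ) z a b‖ ^ 2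
      ≤ 160 * ∑ z : SiteY i, ((((ℓ + 1) ^ (blkOf i.D.toDomains z).1.1 : ℕ) : ℝ)) ^ 2 * ∑ a, ∑ b, ‖(((ω z : ℝ) : ℂ) • Ψ z) a b‖ ^ 2 := by
  have hU : ∀ μ x, U μ x ∈ G := hreg.1
  have hθ : ((d : ℝ) + 1) * θb ≤ 1 / 16 := by linarith
  have hθb1 : θb ≤ 1 / 16 := by
    have : (0 : ℝ) ≤ d := Nat.cast_nonneg d
    nlinarith
  have hm : ∀ z : SiteY i, (0 : ℝ) < (((((ℓ + 1) ^ (blkOf i.D.toDomains z).1.1 : ℕ) : ℝ)) ^ 2)⁻¹ := fun z => inv_pos.2 (by positivity)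
  set Φ := GpY i (parSymY i) U Ψ with hΦ
  have hM0 : 0 ≤ ∑ z : SiteY i, (((((ℓ + 1) ^ (blkOf i.D.toDomains z).1.1 : ℕ) : ℝ)) ^ 2)⁻¹ * ∑ a, ∑ b, ‖(((ω z : ℝ) : ℂ) • Φ z) a b‖ ^ 2 :=
    Finset.sum_nonneg fun z _ => mul_nonneg (hm z).le (hs_nonneg _)
  have hR0 : 0 ≤ ∑ z : SiteY i, ((((ℓ + 1) ^ (blkOf i.D.toDomains z).1.1 : ℕ) : ℝ)) ^ 2 * ∑ a, ∑ b, ‖(((ω z : ℝ) : ℂ) • Ψ z) a b‖ ^ 2 :=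
    Finset.sum_nonneg fun z _ => mul_nonneg (by positivity) (hs_nonneg _)
  -- `c₀M ≤ X` (the conjugated coercivity at `ωΦ`; `conj(ωΦ) = ⟨ω²Φ, Ψ⟩`)
  have hiX := trIP_wsmul_deltaPrimeAY_winv_ge_levelMass i hG hC0 hC1 hreg hω hb1 hb2 hs (fun z => ((ω z : ℝ) : ℂ) • Φ z)
  rw [conj_wsmul_GpY_eq_wsq_pairing i hG hU hω Ψ] at hiX
  -- `X² ≤ M·R`
  have hX2 : trIP (fun _ => (1 : ℝ)) (fun z => ((ω z : ℝ) : ℂ) • (((ω z : ℝ) : ℂ) • Φ z)) Ψ ^ 2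
      ≤ (∑ z : SiteY i, (((((ℓ + 1) ^ (blkOf i.D.toDomains z).1.1 : ℕ) : ℝ)) ^ 2)⁻¹ * ∑ a, ∑ b, ‖(((ω z : ℝ) : ℂ) • Φ z) a b‖ ^ 2)
        * ∑ z : SiteY i, ((((ℓ + 1) ^ (blkOf i.D.toDomains z).1.1 : ℕ) : ℝ)) ^ 2 * ∑ a, ∑ b, ‖(((ω z : ℝ) : ℂ) • Ψ z) a b‖ ^ 2 := by
    have hcs := trIP_wsq_le_sqrt_mul_sqrt (N := N) hm ω Φ Ψ
    have hR : ∑ z : SiteY i, ((((((ℓ + 1) ^ (blkOf i.D.toDomains z).1.1 : ℕ) : ℝ)) ^ 2)⁻¹)⁻¹ * ∑ a, ∑ b, ‖(((ω z : ℝ) : ℂ) • Ψ z) a b‖ ^ 2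
        = ∑ z : SiteY i, ((((ℓ + 1) ^ (blkOf i.D.toDomains z).1.1 : ℕ) : ℝ)) ^ 2 * ∑ a, ∑ b, ‖(((ω z : ℝ) : ℂ) • Ψ z) a b‖ ^ 2 :=
      Finset.sum_congr rfl fun z _ => by rw [inv_inv]
    rw [hR] at hcs
    have hX0 : 0 ≤ trIP (fun _ => (1 : ℝ)) (fun z => ((ω z : ℝ) : ℂ) • (((ω z : ℝ) : ℂ) • Φ z)) Ψ :=
      le_trans (mul_nonneg (by linarith) hM0) hiX
    calc trIP (fun _ => (1 : ℝ)) (fun z => ((ω z : ℝ) : ℂ) • (((ω z : ℝ) : ℂ) • Φ z)) Ψ ^ 2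
        ≤ (Real.sqrt (∑ z : SiteY i, (((((ℓ + 1) ^ (blkOf i.D.toDomains z).1.1 : ℕ) : ℝ)) ^ 2)⁻¹ * ∑ a, ∑ b, ‖(((ω z : ℝ) : ℂ) • Φ z) a b‖ ^ 2)
            * Real.sqrt (∑ z : SiteY i, ((((ℓ + 1) ^ (blkOf i.D.toDomains z).1.1 : ℕ) : ℝ)) ^ 2 * ∑ a, ∑ b, ‖(((ω z : ℝ) : ℂ) • Ψ z) a b‖ ^ 2)) ^ 2 :=
          pow_le_pow_left₀ hX0 hcs 2
      _ = _ := by rw [mul_pow, Real.sq_sqrt hM0, Real.sq_sqrt hR0]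
  -- the energy of the weighted field: `E ≤ X + κM`
  have hE : ∑ ν : Fin (d + 1), trIP (fun _ => (1 : ℝ)) (cdS i U ν (fun w => ((ω w : ℝ) : ℂ) • Φ w)) (cdS i U ν (fun w => ((ω w : ℝ) : ℂ) • Φ w))
      ≤ trIP (fun _ => (1 : ℝ)) (fun z => ((ω z : ℝ) : ℂ) • (((ω z : ℝ) : ℂ) • Φ z)) Ψ + (((d : ℝ) + 1) * θb + θs / 2) *
          ∑ z : SiteY i, (((((ℓ + 1) ^ (blkOf i.D.toDomains z).1.1 : ℕ) : ℝ)) ^ 2)⁻¹ * ∑ a, ∑ b, ‖(((ω z : ℝ) : ℂ) • Φ z) a b‖ ^ 2 := by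
    have h1 := sum_trIP_cdS_le_trIP_deltaPrimeAY i hG (parSymY i) U (parSymY_inv_symm U) (fun z w => parSymY_mem i hU z w) hU
      (fun w => ((ω w : ℝ) : ℂ) • Φ w)
    have h2 := trIP_wsmul_deltaPrimeAY_winv_ge i hG (parSymY i) U (parSymY_inv_symm U) (fun z w => parSymY_mem i hU z w) hU hω hb1 hb2 hs
      (fun w => ((ω w : ℝ) : ℂ) • Φ w)
    rw [conj_wsmul_GpY_eq_wsq_pairing i hG hU hω Ψ] at h2
    linarith
  have hS := sum_wsq_hs_cdS_le i hG hU hω hθb0 hθb1 hb2 Φ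
  exact gradw_arith hiX hX2 hE hS hκ hθ hM0 hR0

/-- ★★ **(3.47)'s GRADIENT ENTRY AT `γ = −1` IN `L²` FORM** (`ω ≡ 1`): on the class, `Σ_ν‖∇_{U,ν}G′(U)Ψ‖²₁ ≤ 160·Σ_z (L^{lev z})²·HS(Ψ(z))` — the gradient of `G′` costs one
power of the local scale, member-∕volume-∕k-∕N-∕U-uniformly. [cite: Balaban1985BackgroundPropagators, Thm 3.1 (3.47) p.398, (3.41) p.397] -/
theorem grad_GpY_le [Nonempty (Fin N)] (hG : G ≤ B7Prop2Explicit.unitaryUnits (Matrix (Fin N) (Fin N) ℂ))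
    {U : CfgY (Matrix (Fin N) (Fin N) ℂ) i} {c α₀ : ℝ} (hC0 : 0 ≤ c * (kGeo i).M * α₀) (hC1 : c * (kGeo i).M * α₀ * ((d : ℝ) + 1) ≤ 1 / 16)
    (hreg : (bg9K (Matrix (Fin N) (Fin N) ℂ) G i).Reg335 c α₀ U) (Ψ : SiteY i → Matrix (Fin N) (Fin N) ℂ) :
    ∑ ν : Fin (d + 1), trIP (fun _ => (1 : ℝ)) (cdS i U ν (GpY i (parSymY i) U Ψ)) (cdS i U ν (GpY i (parSymY i) U Ψ))
      ≤ 160 * ∑ z : SiteY i, ((((ℓ + 1) ^ (blkOf i.D.toDomains z).1.1 : ℕ) : ℝ)) ^ 2 * ∑ a, ∑ b, ‖Ψ z a b‖ ^ 2 := by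
  have hq : (1 : ℝ) / 1 + 1 / 1 - 2 = 0 := by norm_num
  have h := wsq_grad_GpY_le i hG hC0 hC1 hreg (ω := fun _ => (1 : ℝ)) (fun _ => one_pos) (θb := 0) (θs := 0) le_rfl le_rfl
    (fun μ z => by rw [hq, zero_mul]) (fun μ z => by rw [hq, zero_mul]) (fun z w _ => by rw [hq]) (by norm_num) Ψ
  simp only [Complex.ofReal_one, one_smul, one_pow, one_mul] at h
  rw [Finset.sum_comm] at h
  refine le_trans (le_of_eq ?_) h
  exact Finset.sum_congr rfl fun ν _ => trIP_one_self_eq _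

/-- ★★★ **THE EXPONENTIALLY WEIGHTED GRADIENT ESTIMATE** (`ω = e^{δ₀ρ}`, `δ₀ = 1∕(4(d+2))`; `ρ` bond-Lipschitz at scale `(L^{lev})⁻¹`, block oscillation `≤ d+1`): on the
class, for every `Ψ`, `Σ_zΣ_ν e^{2δ₀ρ_z}·HS((∇_{U,ν}G′(U)Ψ)(z)) ≤ 160·Σ_z (L^{lev z})²·e^{2δ₀ρ_z}·HS(Ψ(z))`.
[cite: Balaban1985BackgroundPropagators, Thm 3.1 (3.46)–(3.47) p.398; Agmon1982, Ch.1, Thm 1.5] -/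
theorem wsq_exp_grad_GpY_le_canonical [Nonempty (Fin N)] (hG : G ≤ B7Prop2Explicit.unitaryUnits (Matrix (Fin N) (Fin N) ℂ))
    {U : CfgY (Matrix (Fin N) (Fin N) ℂ) i} {c α₀ : ℝ} (hC0 : 0 ≤ c * (kGeo i).M * α₀) (hC1 : c * (kGeo i).M * α₀ * ((d : ℝ) + 1) ≤ 1 / 16)
    (hreg : (bg9K (Matrix (Fin N) (Fin N) ℂ) G i).Reg335 c α₀ U) {ρ : SiteY i → ℝ}
    (hρ1 : ∀ μ z, |ρ (shiftY i μ z) - ρ z| ≤ ((((ℓ + 1) ^ (blkOf i.D.toDomains z).1.1 : ℕ) : ℝ))⁻¹)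
    (hρ2 : ∀ μ z, |ρ (shiftY i μ z) - ρ z| ≤ ((((ℓ + 1) ^ (blkOf i.D.toDomains (shiftY i μ z)).1.1 : ℕ) : ℝ))⁻¹)
    (hρD : ∀ z w : SiteY i, blkOf i.D.toDomains w = blkOf i.D.toDomains z → |ρ z - ρ w| ≤ (d : ℝ) + 1) (Ψ : SiteY i → Matrix (Fin N) (Fin N) ℂ) :
    ∑ z : SiteY i, ∑ ν : Fin (d + 1), Real.exp ((1 / (4 * ((d : ℝ) + 2))) * ρ z) ^ 2 * ∑ a, ∑ b, ‖cdS i U ν (GpY i (parSymY i) U Ψ) z a b‖ ^ 2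
      ≤ 160 * ∑ z : SiteY i, ((((ℓ + 1) ^ (blkOf i.D.toDomains z).1.1 : ℕ) : ℝ)) ^ 2 *
          (Real.exp ((1 / (4 * ((d : ℝ) + 2))) * ρ z) ^ 2 * ∑ a, ∑ b, ‖Ψ z a b‖ ^ 2) := by
  have hd0 : (0 : ℝ) ≤ d := Nat.cast_nonneg d
  have hd2 : (0 : ℝ) < 4 * ((d : ℝ) + 2) := by positivity
  have hδ0 : (0 : ℝ) ≤ 1 / (4 * ((d : ℝ) + 2)) := by positivity
  have hδ1 : 1 / (4 * ((d : ℝ) + 2)) ≤ 1 := by rw [div_le_one hd2]; linarith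
  have hδD : 1 / (4 * ((d : ℝ) + 2)) * ((d : ℝ) + 1) ≤ 1 := by
    rw [div_mul_eq_mul_div, one_mul, div_le_one hd2]; linarith
  have hδκ0 : (1 / (4 * ((d : ℝ) + 2))) ^ 2 * (2 * ((d : ℝ) + 1) + ((d : ℝ) + 1) ^ 2) ≤ 1 / 16 := by
    rw [div_pow, one_pow, mul_pow, one_div_mul_eq_div, div_le_iff₀ (by positivity)]
    nlinarith
  have hδκ : ((d : ℝ) + 1) * (2 * (1 / (4 * ((d : ℝ) + 2))) ^ 2) + (2 * (1 / (4 * ((d : ℝ) + 2))) ^ 2 * ((d : ℝ) + 1) ^ 2) / 2 ≤ 1 / 16 := by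
    have e : ((d : ℝ) + 1) * (2 * (1 / (4 * ((d : ℝ) + 2))) ^ 2) + (2 * (1 / (4 * ((d : ℝ) + 2))) ^ 2 * ((d : ℝ) + 1) ^ 2) / 2
        = (1 / (4 * ((d : ℝ) + 2))) ^ 2 * (2 * ((d : ℝ) + 1) + ((d : ℝ) + 1) ^ 2) := by ring
    rw [e]; exact hδκ0
  have hω : ∀ z, 0 < Real.exp (1 / (4 * ((d : ℝ) + 2)) * ρ z) := fun z => Real.exp_pos _
  have h := wsq_grad_GpY_le i hG hC0 hC1 hreg hω (by positivity) (by positivity) (fun μ z => bondRatio_exp_le i hδ0 hδ1 μ z (hρ1 μ z))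
    (fun μ z => bondRatio_exp_le' i hδ0 hδ1 μ z (hρ2 μ z)) (fun z w hzw => blockOsc_exp_le i hδ0 hδD z w (hρD z w hzw)) hδκ Ψ
  simp only [hs_real_smul] at h
  exact h

end Literature.MathematicalPhysics.QuantumFieldTheory.Balaban1983to89.B9Thm31SiteGpGradWeightedReg335Y
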